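import Mathlib
import HarnessLib

/-!
# The affine principal minor map and the closedness of its image (Lin–Sturmfels 2009, Thm. 1)

Source: Shaowei Lin, Bernd Sturmfels, *Polynomial relations among principal minors of a
`4 × 4`-matrix*, J. Algebra **322** (2009) 4121–4131, arXiv:0812.0601 [LinSturmfels2009].
Printed (§1): "We denote the principal minors of a complex `n × n`-matrix `A` by `A_I` where
`I ⊆ [n]`. Here, `A_I` is the minor of `A` whose rows and columns are indexed by `I`, including the
`0 × 0`-minor `A_∅ = 1`. Together, they form a vector `A_*` of length `2^n`. … The map
`φ_a : ℂ^{n²} → ℂ^{2^n}, A ↦ A_*` is called the *affine principal minor map* for `n × n`-matrices.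
**Theorem 1.** The image of the affine principal minor map is closed in `ℂ^{2^n}`."
(Proof, §2: cycle-sums; the cycle monomials generate the invariants of diagonal conjugation
`A ↦ D A D⁻¹`, the monomial quotient map has closed image [GMS, KT], and every cycle value is
integral over `ℂ[A_*]`, so bounded principal minors give bounded cycle values and Euclidean limits
lift. "Closed" is proved for Euclidean limits of sequences; for the constructible set `im φ_a`
this is the same as Zariski-closed. `dim im φ_a = n² - n + 1`.)  Also printed there and NOT
vendored: Thm. 2 (for `n = 4` the prime ideal of `im φ_a` is minimally generated by `65`
polynomials of degree `12`), Thm. 3 (projective version, `718` degree-`12` equations, `GL₂(ℂ)⁴`),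
§5 (relation to the `2×2×2×2` hyperdeterminant); Holtz–Sturmfels 2007 / Oeding 2011 (symmetric
case: hyperdeterminantal equations of degree `4`).

Contents:
* `principalMinorMap A : Finset n → R` — the vector of principal minors `I ↦ det A[I, I]` of a
  square matrix over a commutative ring (a REAL definition; `A_∅ = 1` is `Matrix.det_isEmpty`);
* `principalMinorMap_empty` — `A_∅ = 1` (sanity);
* `linSturmfels2009_isClosed_range_principalMinorMap` (NAMED FACT) — Theorem 1: for every `n`,
  `Set.range (principalMinorMap : Matrix (Fin n) (Fin n) ℂ → (Finset (Fin n) → ℂ))` is closed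
  (product = Euclidean topology on `ℂ^{2^n}`).

Purpose: grounds route `ValiantsHypothesis/PrincipalMinorColouring`, crux
`Summit.ValiantsHypothesis.ValiantsHypothesis.Theses.PrincipalMinorColouring.BorderBoundedRank`
(stmt-ValiantsHypothesis-3778). There the coefficient vector of `n!·det(I_R + diag(x∘κ)·K)` is,
by `det(I + DK) = Σ_{T ⊆ [R]} (∏_{i∈T} d_i)·det K_T`, the `κ`-AGGREGATED principal-minor vector
of `K` (coefficient of `x^S` = `n!·Σ_{T : κ(T) = S} det K_T`). For colourings with classes of size
`≤ 1` (`κ` injective, the rung `r = 1`) no aggregation happens: the set of coefficient vectors is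
the image of `im φ_a` under an injective linear map of finite-dimensional spaces, hence CLOSED by
this fact — so at `r = 1` the border crux coincides with `BoundedRankImpossible` (= Ikenmeyer–
Landsberg 2017 Thm. 2.9, fact `ikenmeyerLandsberg2017_perm_no_rankOne_regular`), and the genuine
non-closedness risk recorded on the item is confined to `r ≥ 2`, where the aggregated image is a
linear PROJECTION of the closed set `im φ_a` (projections of closed sets need not be closed).
This corrects the reading "the principal-minor image is not closed (LinSturmfels2009)" in the
route's why-it-might-fail line: Lin–Sturmfels prove the opposite for the un-aggregated map.
-/

noncomputable section

open Matrix

namespace Literature.LinearAlgebra.Matrix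

universe u v

/-- The **affine principal minor map** (Lin–Sturmfels 2009, §1): the vector of all principal
minors `A_I = det A[I, I]`, `I ⊆ [n]`, of a square matrix `A`, including `A_∅ = 1` (the `0 × 0`
minor). Over `ℂ` and `n = Fin k` this is `φ_a : ℂ^{k²} → ℂ^{2^k}`. [cite: LinSturmfels2009, §1] -/
def principalMinorMap {n : Type u} [Fintype n] [DecidableEq n] {R : Type v} [CommRing R]
    (A : Matrix n n R) : Finset n → R :=
  fun I => (A.submatrix (fun i : I => (i : n)) (fun i : I => (i : n))).det

/-- The empty principal minor is `1` (Lin–Sturmfels 2009, §1: "including the `0 × 0`-minor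
`A_∅ = 1`"). [cite: LinSturmfels2009, §1] -/
theorem principalMinorMap_empty {n : Type u} [Fintype n] [DecidableEq n] {R : Type v} [CommRing R]
    (A : Matrix n n R) : principalMinorMap A ∅ = 1 := by
  simp [principalMinorMap]

/-- The full principal minor is the determinant: `A_{[n]} = det A`. [cite: LinSturmfels2009, §1] -/
theorem principalMinorMap_univ {n : Type u} [Fintype n] [DecidableEq n] {R : Type v} [CommRing R]
    (A : Matrix n n R) : principalMinorMap A Finset.univ = A.det := by
  unfold principalMinorMap
  let e : (↥(Finset.univ : Finset n)) ≃ n :=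
    { toFun := fun i => i.1, invFun := fun i => ⟨i, Finset.mem_univ i⟩,
      left_inv := fun i => by simp, right_inv := fun i => by simp }
  exact Matrix.det_submatrix_equiv_self e A

/-- NAMED FACT (**Lin–Sturmfels 2009, Theorem 1**): "The image of the affine principal minor map is
closed in `ℂ^{2^n}`." For every `n`, the range of
`principalMinorMap : Matrix (Fin n) (Fin n) ℂ → (Finset (Fin n) → ℂ)` is a closed subset of
`ℂ^{2^n}` (product = Euclidean topology). The printed proof (§2, cycle-sums, integrality of cycle
values over `ℂ[A_*]`, closed image of the toric quotient by diagonal conjugation) is not vendored;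
users take `(h : linSturmfels2009_isClosed_range_principalMinorMap)`. Trivial for symmetric
matrices, "quite subtle" in general (ibid.). [cite: LinSturmfels2009, Theorem 1] -/
def linSturmfels2009_isClosed_range_principalMinorMap : Prop :=
  ∀ n : ℕ, IsClosed (Set.range
    (principalMinorMap : Matrix (Fin n) (Fin n) ℂ → (Finset (Fin n) → ℂ)))

end Literature.LinearAlgebra.Matrix
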